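import Literature.NumberTheory.EllipticCurves.IwasawaNakayamaProofs
import Summits.BirchSwinnertonDyer.Rank1Residual.Iwasawa.SaturatedQuotientRank
import Summits.BirchSwinnertonDyer.Rank1Residual.Iwasawa.NoFiniteSubmoduleOfSelfDualLayers
import HarnessLib

/-!
# Divisible parts of the finite layers STABILISE when the dual is `Λ`-torsion: the
# "bounded corank" step of Hachimori–Matsuno / Kitajima–Otsuki Prop. 4.4 in the kernel
# (pure algebra; cell `bsd-potss`, seat `bsd-potss-k8q-c5` g4; K8-Gss2 node (R2±)
# `NoFiniteSubmoduleSigned`, items stmt-BirchSwinnertonDyer-19117 / 19222 / 19233, binder 19301)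

HONEST FRAMING (cell `bsd-potss`, run/shared/lean/pub/bsd-potss/; FULL-BSD rank ≤ 1 programme,
tranche 1b): THEOREMS ONLY — additive group theory, Pontryagin-duality bookkeeping over the tree's
axiomatic dual pair `IwasawaDual.IsDualPair`, and the tree's `μ = 0`-type finiteness lemma
(`finite_of_lengthAt_eq_zero`). NO elliptic-curve input, NO named fact, NO definition; nothing is
asserted about any Selmer group; nothing booked; BSD is not proved by any of this.

PURPOSE. Seat g3 put the Hachimori–Matsuno mechanism behind Kitajima–Otsuki 2018 Thm. 4.5 in the
kernel (`forall_finite_eq_bot_of_selfDualLayers`) with ONE displayed input being the STABILISATION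
`r_{n+1}(D_{n+1}) ⊆ r_n(D_n)` (`n ≥ m`) of the divisible parts — in print the sentence "since `X` is
`Λ`-torsion the `ℤ_p`-coranks of `Sel(E/K_n)_div` are bounded, so their images in `Sel(E/K_∞)`
stabilise" (Hachimori–Matsuno p. 2540; Kitajima–Otsuki Prop. 4.4; Greenberg LNM 1716 p. 104). THIS
FILE proves it: for a dual pair `(X, S, toDual)` with `X` finitely generated and `Λ`-torsion, every
increasing sequence of `p`-divisible `Γ`-stable subgroups of `S` is eventually constant
(`exists_forall_le_antitone_of_isTorsion`); hence the images of `p`-divisible, `Γ`-stable,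
transition-compatible `D_n ≤ L_n` stabilise (`exists_forall_map_le_map_of_isTorsion`) and the
criterion holds WITHOUT the stabilisation hypothesis (`forall_finite_eq_bot_of_selfDualLayers_of_isTorsion`).
Proof: the annihilator `A^⊥ ⊆ X` of a `Γ`-stable `A ⊆ S` is a `Λ`-submodule (`T ↦ γ − 1`, constants
through `ℤ/p^k`, local nilpotence), `p`-saturated when `A` is `p`-divisible; `X` is killed by some
`p^k·g`, `p ∤ g`, so `X/A^⊥` is a `ℤ_p`-torsion-free quotient of the `ℤ_p`-finite `X/gX`
(`finite_of_lengthAt_eq_zero`); the ranks `rank_{ℤ_p} X/A_n^⊥` are monotone and bounded, equal ranks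
of nested saturated submodules force equality (rank–nullity over `ℤ_p`), and equal annihilators
force equal subgroups (`ℚ/ℤ` is an injective cogenerator; `toDual` is onto).

References: [HachimoriMatsuno2000] Proc. Amer. Math. Soc. 128 (2000) 2539–2541, proof of the Theorem
(p. 2540); [KitajimaOtsuki2018] Tokyo J. Math. 41 (2018), Prop. 4.4, Thm. 4.5 (arXiv:1607.03612
p. 18); [GreenbergLNM1716] LNM 1716 (1999), proof of Prop. 4.14 (p. 104); [Washington1997] §13.2.
-/

set_option autoImplicit false

noncomputable section

open scoped Classical

open Literature.NumberTheory.EllipticCurves Literature.NumberTheory.EllipticCurves.IwasawaAlgebra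
  Literature.NumberTheory.EllipticCurves.IwasawaDual

namespace Summit.BirchSwinnertonDyer.Rank1Residual.Iwasawa

variable (p : ℕ) [Fact p.Prime]

/-! ## §1 Annihilators of `Γ`-stable subgroups are `Λ`-submodules; divisibility gives saturation -/

section Annihilator

variable {S : Type*} [AddCommGroup S] (ψ : AddMonoid.End S)
  {X : Type*} [AddCommGroup X] [Module (IwasawaAlgebra p) X]
  (toDual : X →+ (S →+ AddCircle (1 : ℚ)))

omit [Fact p.Prime] in
variable {ψ} in
/-- A `ψ`-stable subgroup is `ψ^i`-stable. [folklore] -/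
theorem pow_apply_mem_of_apply_mem {A : AddSubgroup S} (hA : ∀ a ∈ A, ψ a ∈ A) (i : ℕ) :
    ∀ a ∈ A, (ψ ^ i) a ∈ A := by
  induction i with
  | zero => intro a ha; simpa using ha
  | succ i ih =>
    intro a ha
    rw [pow_succ, AddMonoid.End.coe_mul, Function.comp_apply]
    exact ih _ (hA a ha)

variable {p ψ toDual}

/-- **The annihilator of a `ψ`-stable subgroup `A ⊆ S` is `Λ`-stable**: if `toDual x` kills `A`
then so does `toDual (f • x)` for every `f ∈ Λ = ℤ_p⟦T⟧` — write `f = q + Tⁿ v` with `q` a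
polynomial of degree `< n`, where `pⁿ a = 0` and `ψⁿ a = 0` (local nilpotence); the polynomial part
acts through `T ↦ ψ` and `ℤ_p → ℤ/pⁿ`, the tail through `ψⁿ a = 0`.
[cite: GreenbergLNM1716, §1 (p. 60)] -/
theorem toDual_smul_apply_eq_zero (h : IsDualPair p ψ toDual) {A : AddSubgroup S}
    (hA : ∀ a ∈ A, ψ a ∈ A) {x : X} (hx : ∀ a ∈ A, toDual x a = 0) (f : IwasawaAlgebra p) :
    ∀ a ∈ A, toDual (f • x) a = 0 := by
  intro a ha
  obtain ⟨n, hn⟩ := exists_mem_piece h.locNil a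
  rw [mem_piece] at hn
  -- `f - trunc n f = X^n * v`
  have hX : (PowerSeries.X : IwasawaAlgebra p) ^ n ∣
      f - (PowerSeries.trunc n f : PowerSeries ℤ_[p]) := by
    rw [PowerSeries.X_pow_dvd_iff]
    intro m hm
    rw [map_sub, Polynomial.coeff_coe, PowerSeries.coeff_trunc, if_pos hm, sub_self]
  obtain ⟨v, hv⟩ := hX
  have hf : f = (PowerSeries.trunc n f : PowerSeries ℤ_[p]) +
      (PowerSeries.X : IwasawaAlgebra p) ^ n * v := by
    rw [← hv]; ring
  rw [hf, add_smul, map_add, AddMonoidHom.add_apply, mul_smul, h.X_pow_smul, hn.2, map_zero,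
    add_zero]
  -- the polynomial part
  set q : Polynomial ℤ_[p] := PowerSeries.trunc n f
  have hq : (q : PowerSeries ℤ_[p]) = q.eval₂ PowerSeries.C PowerSeries.X :=
    Polynomial.eval₂_C_X_eq_coe.symm
  rw [hq, Polynomial.eval₂_eq_sum_range, Finset.sum_smul, map_sum, AddMonoidHom.finsetSum_apply]
  refine Finset.sum_eq_zero fun i _ ↦ ?_
  rw [mul_smul, h.C_smul _ _ a n hn.1, h.X_pow_smul, hx _ (pow_apply_mem_of_apply_mem hA i a ha),
    smul_zero]

omit [Fact p.Prime] [Module (IwasawaAlgebra p) X] in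
/-- **Divisibility gives saturation**: if `A` is `p`-divisible and `toDual (p • x)` kills `A`, then
`toDual x` kills `A` (`toDual x (p a') = toDual (p x) a'`). [folklore] -/
theorem forall_apply_eq_zero_of_nsmul {A : AddSubgroup S} (hAdiv : ∀ a ∈ A, ∃ a' ∈ A, p • a' = a)
    {x : X} (hx : ∀ a ∈ A, toDual (p • x) a = 0) : ∀ a ∈ A, toDual x a = 0 := by
  intro a ha
  obtain ⟨a', ha', rfl⟩ := hAdiv a ha
  rw [← nsmul_eval, hx a' ha']

omit [Fact p.Prime] [Module (IwasawaAlgebra p) X] in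
/-- Iterated saturation: `toDual (p^k • x)` kills the `p`-divisible `A` only if `toDual x` does.
[folklore] -/
theorem forall_apply_eq_zero_of_pow_nsmul {A : AddSubgroup S}
    (hAdiv : ∀ a ∈ A, ∃ a' ∈ A, p • a' = a) (k : ℕ)
    {x : X} (hx : ∀ a ∈ A, toDual (p ^ k • x) a = 0) : ∀ a ∈ A, toDual x a = 0 := by
  induction k generalizing x with
  | zero => simpa using hx
  | succ k ih =>
    have h1 : ∀ a ∈ A, toDual (p ^ k • (p • x)) a = 0 := by
      intro a ha
      rw [← mul_nsmul, ← pow_succ']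
      exact hx a ha
    exact forall_apply_eq_zero_of_nsmul (p := p) hAdiv (ih h1)

end Annihilator

/-! ## §2 Increasing `p`-divisible `Γ`-stable subgroups of `S` stabilise when `X` is `Λ`-torsion -/

section Stationary

variable {S : Type*} [AddCommGroup S] (ψ : AddMonoid.End S)
  {X : Type*} [AddCommGroup X] [Module (IwasawaAlgebra p) X]
  (toDual : X →+ (S →+ AddCircle (1 : ℚ)))

variable {p ψ toDual}

/-- **Stabilisation of divisible `Γ`-stable subgroups (Hachimori–Matsuno's use of `Λ`-torsion;
Kitajima–Otsuki Prop. 4.4).** Let `(X, S, toDual)` be a dual pair for `ψ` (`T ↦ ψ`), with `X`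
finitely generated and `Λ`-torsion. Then every increasing sequence `A_0 ≤ A_1 ≤ ⋯` of subgroups of
`S` that are `p`-divisible and `ψ`-stable is eventually constant. (In print: the `ℤ_p`-corank of a
divisible subgroup of `Sel_∞` is at most `λ = rank_{ℤ_p} X/X_{ℤ_p-tors}`.)
[cite: HachimoriMatsuno2000, Theorem (proof, p. 2540)]
[cite: KitajimaOtsuki2018, Prop. 4.4 (arXiv:1607.03612 p. 18)]
[cite: GreenbergLNM1716, proof of Prop. 4.14 (p. 104)] -/
theorem exists_forall_le_antitone_of_isTorsion (h : IsDualPair p ψ toDual)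
    [Module.Finite (IwasawaAlgebra p) X] (htor : Module.IsTorsion (IwasawaAlgebra p) X)
    (A : ℕ → AddSubgroup S) (hmono : ∀ n, A n ≤ A (n + 1))
    (hψ : ∀ n, ∀ a ∈ A n, ψ a ∈ A n) (hdiv : ∀ n, ∀ a ∈ A n, ∃ a' ∈ A n, p • a' = a) :
    ∃ m, ∀ n, m ≤ n → A (n + 1) ≤ A n := by
  -- the compatible `ℤ_p`-structure on `X`
  letI : Module ℤ_[p] X := Module.compHom X (algebraMap ℤ_[p] (IwasawaAlgebra p))
  haveI : IsScalarTower ℤ_[p] (IwasawaAlgebra p) X := IsScalarTower.of_compHom ℤ_[p] _ X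
  -- the annihilators `N n = (A n)^⊥`, `Λ`-submodules
  let N : ℕ → Submodule (IwasawaAlgebra p) X := fun n ↦
    { carrier := {x | ∀ a ∈ A n, toDual x a = 0}
      zero_mem' := fun a _ ↦ by rw [map_zero, AddMonoidHom.zero_apply]
      add_mem' := fun {x y} hx hy a ha ↦ by
        rw [map_add, AddMonoidHom.add_apply, hx a ha, hy a ha, add_zero]
      smul_mem' := fun f {x} hx ↦ toDual_smul_apply_eq_zero h (hψ n) hx f }
  have hN : ∀ n (x : X), x ∈ N n ↔ ∀ a ∈ A n, toDual x a = 0 := fun n x ↦ Iff.rfl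
  have hNanti : ∀ n, N (n + 1) ≤ N n := fun n x hx a ha ↦ hx a (hmono n ha)
  have hNsat : ∀ n (x : X), p • x ∈ N n → x ∈ N n := fun n x hx ↦
    (hN n x).mpr (forall_apply_eq_zero_of_nsmul (p := p) (hdiv n) ((hN n _).mp hx))
  -- a `p`-free element `g` with `p^k g X = 0`; then `g X ⊆ N n` for every `n`
  obtain ⟨g, hg, k, hk⟩ := exists_notMem_augIdealP_forall_pow_nsmul_smul_eq_zero p htor
  have hgN : ∀ n (x : X), g • x ∈ N n := by
    intro n x
    refine (hN n _).mpr (forall_apply_eq_zero_of_pow_nsmul (p := p) (hdiv n) k fun a _ ↦ ?_)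
    rw [hk x, map_zero, AddMonoidHom.zero_apply]
  -- the reference submodule `G = g • X ≤ N n`, with `X/G` finitely generated over `ℤ_p`
  let G : Submodule (IwasawaAlgebra p) X :=
    LinearMap.range (g • (LinearMap.id : X →ₗ[IwasawaAlgebra p] X))
  have hGle : ∀ n, G ≤ N n := by
    rintro n _ ⟨y, rfl⟩
    exact hgN n y
  haveI hGfin : Module.Finite ℤ_[p] (X ⧸ G) :=
    module_finite_padicInt_quotient p hg G fun x ↦ ⟨x, rfl⟩
  haveI hNfin : ∀ n, Module.Finite ℤ_[p] (X ⧸ N n) := fun n ↦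
    module_finite_padicInt_quotient p hg (N n) (hgN n)
  -- the ranks `d n = rank_{ℤ_p} X/N n`: monotone and bounded, hence eventually constant
  let d : ℕ → ℕ := fun n ↦ Module.finrank ℤ_[p] (X ⧸ N n)
  have hdmono : Monotone d :=
    monotone_nat_of_le_succ fun n ↦ finrank_quotient_le_of_le p (hNanti n)
  have hdB : ∀ n, d n ≤ Module.finrank ℤ_[p] (X ⧸ G) := fun n ↦
    finrank_quotient_le_of_le p (hGle n)
  obtain ⟨m, hm⟩ := exists_forall_le_eq_of_monotone_of_bounded hdmono hdB
  refine ⟨m, fun n hn ↦ ?_⟩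
  -- equal ranks force `N n = N (n+1)`
  have hNeq : N n = N (n + 1) :=
    eq_of_le_of_finrank_quotient_eq p (hNanti n) (hNsat (n + 1))
      (by change d n = d (n + 1); rw [hm n hn, hm (n + 1) (Nat.le_succ_of_le hn)])
  -- equal annihilators force `A (n+1) ≤ A n`: characters of `S / A n` separate points
  intro a ha
  by_contra haN
  have hne : (QuotientAddGroup.mk' (A n) a) ≠ 0 := by
    rwa [Ne, QuotientAddGroup.mk'_apply, QuotientAddGroup.eq_zero_iff]
  obtain ⟨χ, hχ⟩ := CharacterModule.exists_character_apply_ne_zero_of_ne_zero hne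
  obtain ⟨x, hx⟩ := h.bijective.2 (χ.comp (QuotientAddGroup.mk' (A n)))
  have hxN : x ∈ N n := by
    refine (hN n x).mpr fun b hb ↦ ?_
    rw [hx, AddMonoidHom.comp_apply, QuotientAddGroup.mk'_apply,
      (QuotientAddGroup.eq_zero_iff b).mpr hb, map_zero]
  rw [hNeq] at hxN
  have := (hN (n + 1) x).mp hxN a ha
  rw [hx, AddMonoidHom.comp_apply] at this
  exact hχ this

end Stationary

/-! ## §3 The images of the divisible parts of the layers stabilise; the Hachimori–Matsuno
criterion without the stabilisation hypothesis -/

section Layers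

variable {S : Type*} [AddCommGroup S] (γ : AddMonoid.End S)
  {L : ℕ → Type*} [∀ n, AddCommGroup (L n)]
  (r : ∀ n, L n →+ S) (ι : ∀ n, L n →+ L (n + 1)) (γL : ∀ n, L n →+ L n)
  (D : ∀ n, AddSubgroup (L n)) (pair : ∀ n, L n →+ L n →+ AddCircle (1 : ℚ))
  {X : Type*} [AddCommGroup X] [Module (IwasawaAlgebra p) X]
  (toDual : X →+ (S →+ AddCircle (1 : ℚ)))

/-- **The images `r_n(D_n) ⊆ S` of `p`-divisible, `Γ`-stable, transition-compatible subgroups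
`D_n ≤ L_n` stabilise when `X` is finitely generated and `Λ`-torsion**: there is an `m` with
`r_{n+1}(D_{n+1}) ⊆ r_n(D_n)` for all `n ≥ m` — the displayed stabilisation input `hDst` of
`forall_finite_eq_bot_of_selfDualLayers`, PROVED from `Λ`-torsion (dual pair for `γ − 1`, layer
action `γL_n` over `γ`, transitions `ι_n` over `S` with `ι_n(D_n) ⊆ D_{n+1}`).
[cite: HachimoriMatsuno2000, Theorem (proof, p. 2540)]
[cite: KitajimaOtsuki2018, Prop. 4.4, Thm. 4.5 (arXiv:1607.03612 p. 18)] -/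
theorem exists_forall_map_le_map_of_isTorsion (h : IsDualPair p (γ - 1) toDual)
    [Module.Finite (IwasawaAlgebra p) X] (htor : Module.IsTorsion (IwasawaAlgebra p) X)
    (hι : ∀ n (x : L n), r (n + 1) (ι n x) = r n x)
    (hγL : ∀ n (x : L n), r n (γL n x) = γ (r n x))
    (hDdiv : ∀ n, ∀ d ∈ D n, ∃ d' ∈ D n, p • d' = d)
    (hDγ : ∀ n, ∀ d ∈ D n, γL n d ∈ D n)
    (hDι : ∀ n, ∀ d ∈ D n, ι n d ∈ D (n + 1)) :
    ∃ m, ∀ n, m ≤ n → (D (n + 1)).map (r (n + 1)) ≤ (D n).map (r n) := by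
  refine exists_forall_le_antitone_of_isTorsion h htor (fun n ↦ (D n).map (r n)) ?_ ?_ ?_
  · rintro n _ ⟨d, hd, rfl⟩
    exact ⟨ι n d, hDι n d hd, hι n d⟩
  · rintro n _ ⟨d, hd, rfl⟩
    refine ⟨γL n d - d, (D n).sub_mem (hDγ n d hd) hd, ?_⟩
    rw [map_sub, hγL, IwasawaDual.End_sub_apply, AddMonoid.End.one_apply]
  · rintro n _ ⟨d, hd, rfl⟩
    obtain ⟨d', hd', rfl⟩ := hDdiv n d hd
    exact ⟨r n d', ⟨d', hd', rfl⟩, (map_nsmul _ _ _).symm⟩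

/-- **The Hachimori–Matsuno criterion WITHOUT the stabilisation hypothesis** (for an axiomatic
dual pair for `γ − 1`, `X` finitely generated and `Λ`-torsion): injective exhausting `Γ`-stable
layers with transitions, corestrictions realising the norm `Σ_{i<p} γ^{pⁿ i}` and adjoint to the
transitions, `p`-divisible `γL_n`-stable transition-compatible `D_n`, and `γL_n`-invariant pairings
with right kernel exactly `D_n` representing every character of `L_n/D_n` ⟹ `X` has no non-zero
finite `Λ`-submodule. The stabilisation `r_{n+1}(D_{n+1}) ⊆ r_n(D_n)` (`n ≫ 0`) displayed by g3's
`forall_finite_eq_bot_of_selfDualLayers` is SUPPLIED by `exists_forall_map_le_map_of_isTorsion`.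
[cite: HachimoriMatsuno2000, Theorem and Corollary (i) (p. 2540)]
[cite: KitajimaOtsuki2018, Prop. 4.1, Lemma 4.2, Prop. 4.4, Thm. 4.5 (arXiv:1607.03612 p. 18)] -/
theorem forall_finite_eq_bot_of_selfDualLayers_of_isTorsion (h : IsDualPair p (γ - 1) toDual)
    [Module.Finite (IwasawaAlgebra p) X] (htor : Module.IsTorsion (IwasawaAlgebra p) X)
    (hr : ∀ n, Function.Injective (r n))
    (hι : ∀ n (x : L n), r (n + 1) (ι n x) = r n x)
    (hex : ∀ s : S, ∃ n, ∃ x : L n, r n x = s)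
    (hγL : ∀ n (x : L n), r n (γL n x) = γ (r n x)) (hγLs : ∀ n, Function.Surjective (γL n))
    (hcores : ∀ n (t : L (n + 1)), ∃ t' : L n,
      r n t' = ∑ i ∈ Finset.range p, (γ ^ (p ^ n * i)) (r (n + 1) t) ∧
        ∀ y : L n, pair n y t' = pair (n + 1) (ι n y) t)
    (hDdiv : ∀ n, ∀ d ∈ D n, ∃ d' ∈ D n, p • d' = d)
    (hDγ : ∀ n, ∀ d ∈ D n, γL n d ∈ D n)
    (hDι : ∀ n, ∀ d ∈ D n, ι n d ∈ D (n + 1))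
    (hker : ∀ n (t : L n), (∀ y : L n, pair n y t = 0) → t ∈ D n)
    (hD0 : ∀ n, ∀ t ∈ D n, ∀ y : L n, pair n y t = 0)
    (hsurj : ∀ n (g : L n →+ AddCircle (1 : ℚ)), (∀ d ∈ D n, g d = 0) →
      ∃ c : L n, ∀ y : L n, g y = pair n y c)
    (hinv : ∀ n (y t : L n), pair n (γL n y) (γL n t) = pair n y t) :
    ∀ M : Submodule (IwasawaAlgebra p) X, Finite M → M = ⊥ := by
  obtain ⟨m, hDst⟩ :=
    exists_forall_map_le_map_of_isTorsion p γ r ι γL D toDual h htor hι hγL hDdiv hDγ hDι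
  exact forall_finite_eq_bot_of_selfDualLayers p γ r ι γL D pair toDual hr hι hex hγL hγLs hcores
    hDdiv hDγ m hDst hker hD0 hsurj hinv h.bijective.1 fun x s ↦ by
      rw [h.T_smul, IwasawaDual.End_sub_apply, AddMonoid.End.one_apply, map_sub]

end Layers

end Summit.BirchSwinnertonDyer.Rank1Residual.Iwasawa

end
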